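import Summits.CriticalPhenomena.PercolationContinuityZ3.Theorems.PercNearOneGluingNoHeavyQuantDIBStarFloorSplitInductionLumpy
import Summits.CriticalPhenomena.PercolationContinuityZ3.Theorems.PercNearOneGluingNoHeavyQuantPairCompleting
import HarnessLib

/-!
# QUANT lane R8, Conjecture DIB\* — the lumpy core MINUS the pairwise-completing systems (lead g18 + typer g20):
# `StepLemmaFSLumpyPC ↔ ∀ x < 1, DIBStar x`

builds on p205010 (kernel theorem, internal audit signed; external expert review pending)

Statement + support file (`--supports stmt-CriticalPhenomena-4575`), QUANT lane lead (gen 18).  ONE `Prop` definition (the `@[conjecture]`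
`StepLemmaFSLumpyPC`), theorems otherwise; no sorries, standard axioms.

`…FloorSplitInductionLumpy` (lead g18, p266010) left the LUMPY CORE of T-DIB: `1/2 < x < 1`, empty blobs sure, at least three non-empty lights,
the largest blob bigger than `j/(2x)`.  Typer g20's `IndepBlob.tail_ge_of_pairCompleting` (p265419) proves DIB\* for every system whose non-empty
blobs PAIRWISE COMPLETE (`a k + a l ≥ j + 1`) — in particular for every system all of whose non-empty blobs exceed `j/2` (the 'near-giant'
families that carry the extremal ratio 7/9 of README V209).  This file removes them from the open class:

* `Quant.IndepBlob.StepLemmaFSLumpyPC` (`@[conjecture]`) — `StepLemmaFSLumpy` plus: two distinct non-empty blobs `k, l` with `a k + a l ≤ j`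
  (NOT pairwise completing).
* `Quant.IndepBlob.stepLemmaFSLumpy_of_lumpyPC`, **`stepLemmaFSLumpyPC_iff_dibStar : StepLemmaFSLumpyPC ↔ ∀ x < 1, DIBStar x`.**

OPEN CLASS OF T-DIB after this file: the lumpy core with a NON-COMPLETING PAIR — `1/2 < x < 1`; sizes `≤ j`; heavy total `≤ 2j`; empty blobs
sure; ≥ 3 non-empty lights (`x² < g < x`), light total `≥ j+1`; credit `> 2j`; the largest blob has size `> j/(2x)` and gate `< 1`; and some two
non-empty blobs together do NOT reach `j + 1` (so the system mixes a big blob with genuinely small ones).  [this work]; the gluing rows served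
[cite: KozmaNitzan2024, Conjecture 3 (p. 15)].
-/

namespace Summit.CriticalPhenomena.PercolationContinuityZ3.Theorems

namespace Quant

namespace IndepBlob

open Finset

/-- **CONJECTURE — the floor-split step lemma on the lumpy core with a non-completing pair** (lead g18): `StepLemmaFSLumpy` restricted to
systems having two distinct non-empty blobs `k, l` with `a k + a l ≤ j`.  Equivalent to `∀ x < 1, DIBStar x` (`stepLemmaFSLumpyPC_iff_dibStar`);
the complement inside the lumpy core is typer g20's kernel theorem `tail_ge_of_pairCompleting` (p265419).  builds on p205010 (kernel theorem,
internal audit signed; external expert review pending). [this work] [status: open] -/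
@[conjecture] def StepLemmaFSLumpyPC : Prop :=
  ∀ (κ : Type) [Fintype κ] [DecidableEq κ] (a : κ → ℕ) (g : κ → ℝ) (j : ℕ) (x : ℝ),
    1 / 2 < x → x < 1 →
    (∀ k, 0 ≤ g k ∧ g k ≤ 1) →
    (∀ k, g k < x → a k ≤ j) →
    (∑ k ∈ Finset.univ.filter (fun k => x ≤ g k), a k ≤ 2 * j) →
    (∀ k, x ≤ g k → a k ≤ j) →
    (∃ k₁ k₂ k₃, k₁ ≠ k₂ ∧ k₁ ≠ k₃ ∧ k₂ ≠ k₃ ∧ g k₁ < x ∧ 0 < a k₁ ∧ g k₂ < x ∧ 0 < a k₂ ∧ g k₃ < x ∧ 0 < a k₃) →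
    (j + 1 ≤ ∑ k ∈ Finset.univ.filter (fun k => g k < x), a k) →
    (∀ k, g k < x → 0 < a k → x ^ 2 < g k) →
    (∀ k, (∀ i, a i ≤ a k) → g k < 1) →
    (∀ k, a k = 0 → g k = 1) →
    (∃ k, (j : ℝ) < 2 * x * a k) →
    (∃ k l, k ≠ l ∧ 0 < a k ∧ 0 < a l ∧ a k + a l ≤ j) →
    (2 * j : ℝ) < ∑ k, (a k : ℝ) * (if x ≤ g k then g k else (g k - x ^ 2) / (1 - x)) →
    (∀ k, 0 < a k → RootDec.CappedRows (Function.update a k 0) g) →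
    x ≤ ∑ W : Finset κ, (∏ k, if k ∈ W then g k else 1 - g k) * (if j + 1 ≤ ∑ k ∈ W, a k then (1 : ℝ) else 0)

/-- The narrowed step lemma follows from DIB\* below one. [this work] -/
theorem stepLemmaFSLumpyPC_of_dibStar (h : ∀ x : ℝ, x < 1 → DIBStar x) : StepLemmaFSLumpyPC :=
  fun κ _ _ a g j x _ hx1 hg hlight _ _ _ _ _ _ _ _ _ hcredit _ => h x hx1 κ a g j hg hlight hcredit

/-- **Pairwise-completing systems are kernel (typer g20)**: `StepLemmaFSLumpyPC → StepLemmaFSLumpy`. [this work] -/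
theorem stepLemmaFSLumpy_of_lumpyPC (H : StepLemmaFSLumpyPC) : StepLemmaFSLumpy := by
  intro κ _ _ a g j x hx hx1 hg hlight hcorner hnogiant hthree hbig hpos hcore hempty hgran hcredit hIH
  by_cases hpc : ∀ k l, k ≠ l → 0 < a k → 0 < a l → j + 1 ≤ a k + a l
  · exact tail_ge_of_pairCompleting x hx.le hx1 a g j hg hlight hpc hcredit
  · push Not at hpc
    obtain ⟨k, l, hkl, hk, hl, hsum⟩ := hpc
    exact H κ a g j x hx hx1 hg hlight hcorner hnogiant hthree hbig hpos hcore hempty hgran ⟨k, l, hkl, hk, hl, by omega⟩ hcredit hIH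

/-- **`StepLemmaFSLumpyPC ⟹ DIB\*` at every floor `x < 1`.** [this work] -/
theorem dibStar_of_stepLemmaFSLumpyPC (H : StepLemmaFSLumpyPC) (x : ℝ) (hx1 : x < 1) : DIBStar x :=
  dibStar_of_stepLemmaFSLumpy (stepLemmaFSLumpy_of_lumpyPC H) x hx1

/-- **T-DIB ≡ the step lemma on the lumpy core with a non-completing pair**: `StepLemmaFSLumpyPC ↔ ∀ x < 1, DIBStar x`. [this work] -/
theorem stepLemmaFSLumpyPC_iff_dibStar : StepLemmaFSLumpyPC ↔ ∀ x : ℝ, x < 1 → DIBStar x :=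
  ⟨fun H x hx => dibStar_of_stepLemmaFSLumpyPC H x hx, stepLemmaFSLumpyPC_of_dibStar⟩

end IndepBlob

end Quant

end Summit.CriticalPhenomena.PercolationContinuityZ3.Theorems
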